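import Mathlib.LinearAlgebra.Matrix.ConjTranspose
import Mathlib.LinearAlgebra.Matrix.Trace
import Mathlib.LinearAlgebra.Dimension.Constructions
import Mathlib.Algebra.Star.BigOperators
import Literature.Computability.AlgebraicComplexity.WordTypes
import HarnessLib

/-!
# Kronecker powers of matrices and the commutant of the permutation action on words

Topic: `Literature/Computability/AlgebraicComplexity`; support file for the elementary proof of
CVZ Thm. 3.34 (`ChristandlVranaZuiddam2023_le_upperSupportFunctional`, `QuantumFunctionals.lean`).
The symmetric group `S_n` acts on words `u : Fin n → ι` by permuting positions, hence on the space
`ℂ^{ι^n} = (ℂ^ι)^{⊗n}` of functions on words. The printed proof of Thm. 3.34 works with the isotypic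
projectors of this action (Schur–Weyl duality); the proof in this tree only needs its *commutant*:
the matrices `T` on words with `T_{u∘σ, u'∘σ} = T_{u,u'}`, which contain every Kronecker power
`A^{⊗n}` and are spanned by the indicator matrices of the joint-type classes
`{(u, u') | type(u, u') = τ}` (a standard fact of Schur–Weyl theory, here in its elementary form:
an `S_n`-invariant kernel is a function of the joint type).

## Content

* `powMat A n` — the Kronecker power `A^{⊗n}` as a matrix on words, entries `∏ₘ A (u m) (u' m)`;
  multiplicativity, `1^{⊗n} = 1`, `(Aᴴ)^{⊗n} = (A^{⊗n})ᴴ`, diagonal matrices, trace `(tr A)^n`.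
* `IsPermInvariant T` — `T_{u∘σ, u'∘σ} = T_{u,u'}` for all `σ ∈ S_n`; stable under products, satisfied
  by `powMat A n`; `IsPermInvariant.apply_eq_of_letterCount_eq`: the entry `T_{u,u'}` only depends on
  the joint type of `(u, u')` (words of equal type differ by a permutation, `WordTypes.lean`).
* `jointTypeIndicator τ u'` — the indicator function of `{u | type(u, u') = τ}`; `jointTypes n` — the
  finite set of joint types of pairs of words of length `n` (at most `(n+1)^{|ι'||ι|}` of them).
* `commutantSpan L` — for a finite set `L` of words, the span `𝒲(L)` of the indicators
  `jointTypeIndicator τ u'`, `τ` a joint type, `u' ∈ L`. Key facts: every column `T(·, u')`, `u' ∈ L`,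
  of a permutation-invariant `T` lies in `𝒲(L)` (`IsPermInvariant.col_mem_commutantSpan`), `𝒲(L)` is
  stable under every permutation-invariant square matrix (`IsPermInvariant.mulVec_mem_commutantSpan`),
  and `dim 𝒲(L) ≤ |jointTypes n| · |L|` (`finrank_commutantSpan_le`). In the language of the source,
  `𝒲(L)` is the `ℂ[S_n]'`-submodule generated by the basis vectors `e_{u'}`, `u' ∈ L`; it replaces the
  isotypic components "touched" by `L`.

## Relation to existing declarations of the tree (library fit)

Two other files of the tree already hold the *square* special cases of the first two notions, built
for a different purpose (pair-word polynomials in Diophantine geometry) and with a heavy import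
closure, which is why they are not imported here:
* `Literature.NumberTheory.DiophantineGeometry.kronPow` (`PairWordPolynomials.lean`; square `A`,
  `CommRing`) and the earlier `Literature.NumberTheory.DiophantineGeometry.tensorPowerMatrix`
  (`TensorWordModel.lean`, alphabet `Fin N`; bridged there by `kronPow_eq_tensorPowerMatrix`) are
  entrywise *definitionally* the square case of `powMat`: `kronPow (D := n) A = powMat A n` holds by
  `rfl` (both are `Matrix.of fun u u' => ∏ m, A (u m) (u' m)`).
* `Literature.NumberTheory.DiophantineGeometry.IsPermInvariant` (`PairWordPolynomials.lean`; square
  matrices, phrased with `Matrix.submatrix (compPerm τ)`) is equivalent to the square case of the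
  `IsPermInvariant` below through its entrywise form `IsPermInvariant.apply_comp`.
The versions in this file are the general ones (rectangular `ι' × ι`, any `CommSemiring`, which the
column expansion and the stability of `𝒲(L)` need) and are intended as the survivors of a later
librarian unification; an `rfl`/`Iff` bridge belongs in a downstream file importing both sides.
`commutantSpan` is deliberately `ℂ`-specific (it is only used for complex tensors).

References: M. Christandl, P. Vrana, J. Zuiddam, *Universal points in the asymptotic spectrum of
tensors*, J. Amer. Math. Soc. 36 (2023), §3.1 and Rem. 3.33; the commutant description is classical
Schur–Weyl theory (e.g. R. Goodman, N. Wallach, *Symmetry, Representations, and Invariants* (2009),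
§4.2.4), used here only in the elementary form proved below. All statements are folklore.
-/

noncomputable section

open scoped BigOperators Matrix

namespace Literature.Computability.AlgebraicComplexity

/-! ## Kronecker powers of a matrix -/

section PowMat

variable {R : Type*} [CommSemiring R] {ι ι' ι'' : Type*} {n : ℕ}

/-- The **Kronecker power** `A^{⊗n}` of a (rectangular) matrix, as a matrix indexed by words:
`(A^{⊗n})_{u,u'} = ∏ₘ A_{u m, u' m}`. It is the matrix of `A ⊗ ⋯ ⊗ A` on `(R^ι)^{⊗n} ≅ R^{ι^n}`.
Square special cases already in the tree (entrywise definitionally equal, `kronPow (D := n) A =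
powMat A n` by `rfl`): `Literature.NumberTheory.DiophantineGeometry.kronPow` and
`Literature.NumberTheory.DiophantineGeometry.tensorPowerMatrix`; this rectangular `CommSemiring`
version is the intended survivor of a librarian unification. [folklore] -/
def powMat (A : Matrix ι' ι R) (n : ℕ) : Matrix (Fin n → ι') (Fin n → ι) R :=
  Matrix.of fun u u' => ∏ m, A (u m) (u' m)

/-- Entries of `A^{⊗n}`. [folklore] -/
@[simp] theorem powMat_apply (A : Matrix ι' ι R) (n : ℕ) (u : Fin n → ι') (u' : Fin n → ι) :
    powMat A n u u' = ∏ m, A (u m) (u' m) := rfl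

/-- `(A B)^{⊗n} = A^{⊗n} B^{⊗n}`. [folklore] -/
theorem powMat_mul [Fintype ι'] (A : Matrix ι'' ι' R) (B : Matrix ι' ι R) (n : ℕ) :
    powMat (A * B) n = powMat A n * powMat B n := by
  ext u u'
  simp only [powMat_apply, Matrix.mul_apply]
  rw [Fintype.prod_sum fun (m : Fin n) (j : ι') => A (u m) j * B j (u' m)]
  exact Finset.sum_congr rfl fun v _ => Finset.prod_mul_distrib

/-- `1^{⊗n} = 1`. [folklore] -/
@[simp] theorem powMat_one [Fintype ι] [DecidableEq ι] (n : ℕ) :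
    powMat (1 : Matrix ι ι R) n = 1 := by
  ext u u'
  simp only [powMat_apply, Matrix.one_apply]
  by_cases h : u = u'
  · subst h; simp
  · rw [if_neg h]
    obtain ⟨m, hm⟩ := Function.ne_iff.1 h
    exact Finset.prod_eq_zero (Finset.mem_univ m) (if_neg hm)

/-- `(Aᴴ)^{⊗n} = (A^{⊗n})ᴴ`. [folklore] -/
theorem powMat_conjTranspose [StarRing R] (A : Matrix ι' ι R) (n : ℕ) :
    powMat Aᴴ n = (powMat A n)ᴴ := by
  ext u u'
  simp only [powMat_apply, Matrix.conjTranspose_apply, star_prod]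

/-- `star A^{⊗n}` for square matrices over a star ring is `(star A)^{⊗n}`. [folklore] -/
theorem star_powMat [StarRing R] (A : Matrix ι ι R) (n : ℕ) :
    star (powMat A n) = powMat (star A) n := by
  rw [Matrix.star_eq_conjTranspose, Matrix.star_eq_conjTranspose, powMat_conjTranspose]

/-- The Kronecker power of a diagonal matrix is diagonal with product entries. [folklore] -/
theorem powMat_diagonal [DecidableEq ι] (d : ι → R) (n : ℕ) :
    powMat (Matrix.diagonal d) n = Matrix.diagonal fun u : Fin n → ι => ∏ m, d (u m) := by
  ext u u'
  simp only [powMat_apply, Matrix.diagonal_apply]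
  by_cases h : u = u'
  · subst h; simp
  · rw [if_neg h]
    obtain ⟨m, hm⟩ := Function.ne_iff.1 h
    exact Finset.prod_eq_zero (Finset.mem_univ m) (if_neg hm)

/-- `tr A^{⊗n} = (tr A)^n`. [folklore] -/
theorem trace_powMat [Fintype ι] (A : Matrix ι ι R) (n : ℕ) :
    (powMat A n).trace = A.trace ^ n := by
  simp only [Matrix.trace, Matrix.diag, powMat_apply]
  exact (Fintype.sum_pow (fun i => A i i) n).symm

/-- A product of two Kronecker powers with `star A * A = 1` collapses: `(star A)^{⊗n} A^{⊗n} = 1`.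
[folklore] -/
theorem powMat_star_mul_self [Fintype ι] [DecidableEq ι] [StarRing R] {A : Matrix ι ι R}
    (hA : star A * A = 1) (n : ℕ) : powMat (star A) n * powMat A n = 1 := by
  rw [← powMat_mul, hA, powMat_one]

/-- Likewise `A^{⊗n} (star A)^{⊗n} = 1` when `A * star A = 1`. [folklore] -/
theorem powMat_self_mul_star [Fintype ι] [DecidableEq ι] [StarRing R] {A : Matrix ι ι R}
    (hA : A * star A = 1) (n : ℕ) : powMat A n * powMat (star A) n = 1 := by
  rw [← powMat_mul, hA, powMat_one]

end PowMat

/-! ## Permutation-invariant matrices on words (the commutant of `S_n`) -/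

section PermInvariant

variable {R : Type*} {ι ι' ι'' : Type*} {n : ℕ}

/-- A matrix on words **commutes with the permutation action** of `S_n` on positions:
`T_{u∘σ, u'∘σ} = T_{u,u'}` for every `σ`. (For square `T` this says `T π_σ = π_σ T` for the
permutation operators `π_σ`.) The square case already exists in the tree as
`Literature.NumberTheory.DiophantineGeometry.IsPermInvariant` (phrased with
`Matrix.submatrix (compPerm τ)`; equivalent to this entrywise form through its lemma
`IsPermInvariant.apply_comp`); this rectangular version is the intended survivor of a librarian
unification. [folklore] -/
def IsPermInvariant (T : Matrix (Fin n → ι') (Fin n → ι) R) : Prop :=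
  ∀ (σ : Equiv.Perm (Fin n)) (u : Fin n → ι') (u' : Fin n → ι), T (u ∘ σ) (u' ∘ σ) = T u u'

/-- Unfolding of `IsPermInvariant`. [folklore] -/
theorem isPermInvariant_iff (T : Matrix (Fin n → ι') (Fin n → ι) R) :
    IsPermInvariant T ↔
      ∀ (σ : Equiv.Perm (Fin n)) (u : Fin n → ι') (u' : Fin n → ι), T (u ∘ σ) (u' ∘ σ) = T u u' :=
  Iff.rfl

/-- **An invariant kernel is a function of the joint type**: if `T` is permutation invariant and the
pair words `(u₁, u')`, `(u₂, u')` have the same type, then `T_{u₁,u'} = T_{u₂,u'}`. [folklore] -/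
theorem IsPermInvariant.apply_eq_of_letterCount_eq [DecidableEq ι] [DecidableEq ι']
    {T : Matrix (Fin n → ι') (Fin n → ι) R} (hT : IsPermInvariant T) {u₁ u₂ : Fin n → ι'}
    {u' : Fin n → ι} (h : letterCount (fun m => (u₁ m, u' m)) = letterCount (fun m => (u₂ m, u' m))) :
    T u₁ u' = T u₂ u' := by
  obtain ⟨σ, hσ⟩ := exists_perm_of_letterCount_eq h
  have h1 : u₂ ∘ σ = u₁ := funext fun m => (Prod.ext_iff.1 (hσ m)).1
  have h2 : u' ∘ σ = u' := funext fun m => (Prod.ext_iff.1 (hσ m)).2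
  rw [← hT σ u₂ u', h1, h2]

variable [CommSemiring R]

/-- **Kronecker powers are permutation invariant.** [folklore] -/
theorem IsPermInvariant.powMat (A : Matrix ι' ι R) (n : ℕ) : IsPermInvariant (powMat A n) := by
  intro σ u u'
  simp only [powMat_apply, Function.comp_apply]
  exact Fintype.prod_equiv σ (fun m => A (u (σ m)) (u' (σ m))) (fun m => A (u m) (u' m))
    fun _ => rfl

/-- Reindexing a sum over words by precomposition with a permutation of positions. [folklore] -/
theorem sum_comp_perm_eq {M : Type*} [AddCommMonoid M] [Fintype ι] [DecidableEq ι]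
    (σ : Equiv.Perm (Fin n)) (F : (Fin n → ι) → M) : ∑ v : Fin n → ι, F (v ∘ σ) = ∑ v, F v :=
  Fintype.sum_equiv (Equiv.arrowCongr σ.symm (Equiv.refl ι)) (fun v => F (v ∘ σ)) F fun v => by
    congr 1

/-- Products of permutation-invariant matrices are permutation invariant (the commutant is an
algebra). [folklore] -/
theorem IsPermInvariant.mul [Fintype ι'] [DecidableEq ι'] {T : Matrix (Fin n → ι'') (Fin n → ι') R}
    {S : Matrix (Fin n → ι') (Fin n → ι) R} (hT : IsPermInvariant T) (hS : IsPermInvariant S) :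
    IsPermInvariant (T * S) := by
  intro σ u u'
  simp only [Matrix.mul_apply]
  rw [← sum_comp_perm_eq σ fun v => T (u ∘ σ) v * S v (u' ∘ σ)]
  exact Finset.sum_congr rfl fun v _ => by rw [hT σ u v, hS σ v u']

variable [DecidableEq ι] [DecidableEq ι'] [Fintype ι] [Fintype ι']

/-- The **indicator of a joint-type class**: `jointTypeIndicator τ u' u = [type(u, u') = τ]`.
[folklore] -/
def jointTypeIndicator (τ : ι' × ι → ℕ) (u' : Fin n → ι) : (Fin n → ι') → R :=
  fun u => if letterCount (fun m => (u m, u' m)) = τ then 1 else 0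

/-- Unfolding of `jointTypeIndicator`. [folklore] -/
theorem jointTypeIndicator_apply (τ : ι' × ι → ℕ) (u' : Fin n → ι) (u : Fin n → ι') :
    (jointTypeIndicator τ u' u : R) = if letterCount (fun m => (u m, u' m)) = τ then 1 else 0 := rfl

end PermInvariant

section JointTypes

/-- The finite set of **joint types** of pairs of words of length `n` over `ι'` and `ι`. [folklore] -/
def jointTypes (ι' ι : Type*) [DecidableEq ι] [DecidableEq ι'] [Fintype ι] [Fintype ι'] (n : ℕ) :
    Finset (ι' × ι → ℕ) :=
  Finset.univ.image fun p : (Fin n → ι') × (Fin n → ι) => letterCount fun m => (p.1 m, p.2 m)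

end JointTypes

section ColumnExpansion

variable {R : Type*} [CommSemiring R] {ι ι' : Type*} {n : ℕ} [DecidableEq ι] [DecidableEq ι']
  [Fintype ι] [Fintype ι']

/-- The joint type of a pair of words is a joint type. [folklore] -/
theorem letterCount_pair_mem_jointTypes (u : Fin n → ι') (u' : Fin n → ι) :
    (letterCount fun m => (u m, u' m)) ∈ jointTypes ι' ι n :=
  Finset.mem_image.2 ⟨(u, u'), Finset.mem_univ _, rfl⟩

/-- **There are at most `(n+1)^{|ι'||ι|}` joint types.** [folklore] -/
theorem card_jointTypes_le :
    (jointTypes ι' ι n).card ≤ (n + 1) ^ (Fintype.card ι' * Fintype.card ι) := by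
  have h : jointTypes ι' ι n ⊆ Finset.univ.image (letterCount : (Fin n → ι' × ι) → ι' × ι → ℕ) := by
    intro τ hτ
    obtain ⟨p, -, rfl⟩ := Finset.mem_image.1 hτ
    exact Finset.mem_image.2 ⟨_, Finset.mem_univ _, rfl⟩
  refine (Finset.card_le_card h).trans ?_
  simpa [Fintype.card_prod] using (card_image_letterCount_le (ι := ι' × ι) (n := n))

/-- **Column expansion**: a column `T(·, u')` of a permutation-invariant matrix is a combination of
the joint-type indicators `jointTypeIndicator τ u'`, `τ ∈ jointTypes`. [folklore] -/
theorem IsPermInvariant.col_eq_sum {T : Matrix (Fin n → ι') (Fin n → ι) R} (hT : IsPermInvariant T)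
    (u' : Fin n → ι) :
    ∃ c : (ι' × ι → ℕ) → R, (fun u => T u u') =
      ∑ τ ∈ jointTypes ι' ι n, c τ • (jointTypeIndicator τ u' : (Fin n → ι') → R) := by
  classical
  refine ⟨fun τ => if h : ∃ v : Fin n → ι', letterCount (fun m => (v m, u' m)) = τ then
    T (Classical.choose h) u' else 0, ?_⟩
  funext u
  simp only [Finset.sum_apply, Pi.smul_apply, jointTypeIndicator_apply, smul_eq_mul, mul_ite,
    mul_one, mul_zero]
  rw [Finset.sum_ite_eq (jointTypes ι' ι n) (letterCount fun m => (u m, u' m)),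
    if_pos (letterCount_pair_mem_jointTypes u u')]
  have hex : ∃ v : Fin n → ι', letterCount (fun m => (v m, u' m)) =
      letterCount fun m => (u m, u' m) := ⟨u, rfl⟩
  rw [dif_pos hex]
  exact hT.apply_eq_of_letterCount_eq (Classical.choose_spec hex).symm

end ColumnExpansion

/-! ## The commutant span `𝒲(L)` of a set of words -/

section CommutantSpan

variable {ι ι' : Type*} [DecidableEq ι] [DecidableEq ι'] [Fintype ι] [Fintype ι'] {n : ℕ}

variable (ι') in
/-- The **commutant span** `𝒲(L)` of a finite set `L` of words of length `n` over `ι`, inside the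
complex functions on words over `ι'` (deliberately `ℂ`-specific: it is used for complex tensors only):
the `ℂ`-span of the joint-type indicators `jointTypeIndicator τ u'` with `τ` a joint type and
`u' ∈ L`. It contains `T e_{u'}` for every permutation-invariant `T` and `u' ∈ L`, and is stable
under the commutant of `S_n`. [folklore] -/
def commutantSpan (L : Finset (Fin n → ι)) : Submodule ℂ ((Fin n → ι') → ℂ) :=
  Submodule.span ℂ
    ((jointTypes ι' ι n ×ˢ L).image fun p => (jointTypeIndicator p.1 p.2 : (Fin n → ι') → ℂ))

/-- The generators lie in `𝒲(L)`. [folklore] -/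
theorem jointTypeIndicator_mem_commutantSpan {L : Finset (Fin n → ι)} {τ : ι' × ι → ℕ}
    (hτ : τ ∈ jointTypes ι' ι n) {u' : Fin n → ι} (hu' : u' ∈ L) :
    (jointTypeIndicator τ u' : (Fin n → ι') → ℂ) ∈ commutantSpan ι' L :=
  Submodule.subset_span (Finset.mem_coe.2 (Finset.mem_image.2 ⟨(τ, u'), Finset.mem_product.2 ⟨hτ, hu'⟩, rfl⟩))

/-- **Dimension bound**: `dim 𝒲(L) ≤ |jointTypes| · |L|`. [folklore] -/
theorem finrank_commutantSpan_le (L : Finset (Fin n → ι)) :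
    Module.finrank ℂ (commutantSpan ι' L) ≤ (jointTypes ι' ι n).card * L.card := by
  refine (finrank_span_finset_le_card _).trans ?_
  exact Finset.card_image_le.trans (Finset.card_product _ _).le

/-- `dim 𝒲(L) ≤ (n+1)^{|ι'||ι|} · |L|`. [folklore] -/
theorem finrank_commutantSpan_le_pow (L : Finset (Fin n → ι)) :
    Module.finrank ℂ (commutantSpan ι' L) ≤ (n + 1) ^ (Fintype.card ι' * Fintype.card ι) * L.card :=
  (finrank_commutantSpan_le L).trans (Nat.mul_le_mul_right _ card_jointTypes_le)

/-- **Columns of invariant matrices lie in `𝒲(L)`**: for a permutation-invariant `T` and `u' ∈ L`,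
`T e_{u'} = T(·, u') ∈ 𝒲(L)`. [folklore] -/
theorem IsPermInvariant.col_mem_commutantSpan {T : Matrix (Fin n → ι') (Fin n → ι) ℂ}
    (hT : IsPermInvariant T) {L : Finset (Fin n → ι)} {u' : Fin n → ι} (hu' : u' ∈ L) :
    (fun u => T u u') ∈ commutantSpan ι' L := by
  obtain ⟨c, hc⟩ := hT.col_eq_sum u'
  rw [hc]
  exact Submodule.sum_mem _ fun τ hτ =>
    Submodule.smul_mem _ _ (jointTypeIndicator_mem_commutantSpan hτ hu')

/-- The matrix `K_τ` of a joint-type class, `(K_τ)_{v,u'} = [type(v,u') = τ]`, is permutation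
invariant. [folklore] -/
theorem isPermInvariant_jointTypeIndicator (τ : ι' × ι → ℕ) :
    IsPermInvariant (Matrix.of fun (v : Fin n → ι') (u' : Fin n → ι) =>
      (jointTypeIndicator τ u' v : ℂ)) := by
  intro σ v u'
  simp only [Matrix.of_apply, jointTypeIndicator_apply]
  rw [show (fun m => ((v ∘ σ) m, (u' ∘ σ) m)) = (fun m => (v m, u' m)) ∘ σ from rfl,
    letterCount_comp_perm]

/-- **`𝒲(L)` is stable under the commutant**: a permutation-invariant square matrix maps `𝒲(L)`
into itself. [folklore] -/
theorem IsPermInvariant.mulVec_mem_commutantSpan {T : Matrix (Fin n → ι') (Fin n → ι') ℂ}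
    (hT : IsPermInvariant T) {L : Finset (Fin n → ι)} {f : (Fin n → ι') → ℂ}
    (hf : f ∈ commutantSpan ι' L) : T *ᵥ f ∈ commutantSpan ι' L := by
  -- the set of `f` with `T f ∈ 𝒲(L)` is a submodule containing the generators
  have key : commutantSpan ι' L ≤ (commutantSpan ι' L).comap (Matrix.mulVecLin T) := by
    refine Submodule.span_le.2 ?_
    rintro _ hg
    obtain ⟨⟨τ, u'⟩, hp, rfl⟩ := Finset.mem_image.1 (Finset.mem_coe.1 hg)
    obtain ⟨-, hu'⟩ := Finset.mem_product.1 hp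
    simp only [Submodule.mem_comap, Matrix.mulVecLin_apply, SetLike.mem_coe]
    -- `T K_τ e_{u'}` is the `u'`-column of the invariant matrix `T K_τ`
    set K : Matrix (Fin n → ι') (Fin n → ι) ℂ :=
      Matrix.of fun (v : Fin n → ι') (w : Fin n → ι) => (jointTypeIndicator τ w v : ℂ) with hK
    have hTK : IsPermInvariant (T * K) := hT.mul (isPermInvariant_jointTypeIndicator τ)
    have hcol : T *ᵥ (jointTypeIndicator τ u' : (Fin n → ι') → ℂ) = fun v => (T * K) v u' := by
      funext v
      simp only [Matrix.mulVec, dotProduct, Matrix.mul_apply, hK, Matrix.of_apply]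
    rw [hcol]
    exact hTK.col_mem_commutantSpan hu'
  exact key hf

end CommutantSpan

end Literature.Computability.AlgebraicComplexity
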